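import Summits.CriticalPhenomena.CardyFormulaZ2.Theorems.CardyAnchoredRigiditySubseqCardyQuasiadditive
import Summits.CriticalPhenomena.CardyFormulaZ2.Theorems.CardyAnchoredRigiditySubseqCardyLatticeSubmult
import Literature.Probability.Percolation.RSWProofs

/-!
# Lattice strip crossing rates of critical bond percolation on `ℤ²` (Fekete at fixed height)
# (crux `SubseqCardy`, stmt-CriticalPhenomena-5768, line `registered`, lead c6: kernel facts VI, part 1)

Route `CardyAnchoredRigidity` (decl shared with `CardyLocalRigidity`), sub-problem `CardyFormulaZ2`.
With `h(a, n) := crossingProb half a n = P_{1/2}(LR([0, a] × [0, n]))` (bond percolation on `ℤ²` at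
`p = 1/2`), at FIXED height `n` the width dependence is exponential with a well-defined rate `ν = ν_n`:
`lattice_stripRate` gives `ν` with `log 2 / (n + 2) ≤ ν`, `ν (n + 2) ≤ log 2 - log h(2n + 3, n)` and
`e^{-ν (a + 1)} ≤ h(a, n) ≤ 2 e^{ν (n + 1 - a)}` (upper bound for `a ≥ n`); `lattice_stripRate_tendsto`:
any such `ν` is `lim_{a → ∞} -log h(a, n) / a` (squeeze between `ν (1 - (n + 1)/a) - log 2 / a` and
`ν (1 + 1/a)`).

Proof: the two-sided real-variable Fekete lemma `quasiadditive_linear_sandwich` (lead c6, kernel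
facts IV, part 2) applied with `k := n + 2`, `C := log 2` to `A w := -log h(⌊k w⌋₊ - 1, n)` (`ℕ`-floor,
truncated subtraction): `A` is non-negative (`h ≤ 1`), non-decreasing (`crossingProb_anti_left`),
superadditive (sub-multiplicativity `Lattice.crossingProb_add_succ_le_mul`, `h(0, n) = 1`) and nearly
subadditive, `A (s + t - 1) ≤ A s + A t + log 2` for `s, t ≥ 1`, by Harris gluing through the `n × n`
square (`crossingProb_glue_holds` with `h(n, n) ≥ 1/2`). With the slope `l`: `ν := l / k`;
`A 1 = -log h(n + 1, n) = log 2` (`crossingProb_half_succ_self_holds`), `A 2 = -log h(2n + 3, n)`, and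
`w := (a + 1) / k` reads off the sandwich at the lattice index `a`.

References: B. Bollobás, O. Riordan, *Percolation* (2006), Ch. 3, eq. (2), (3) and (12);
M. Fekete, Math. Z. 17 (1923). Helpers: inner namespace `Lattice`, prefix `stripRate_`.
-/

noncomputable section

namespace Summit.CriticalPhenomena.CardyFormulaZ2.Cruxes.SubseqCardy.Birth

open Set Filter Topology
open Literature.Probability.LatticeModels
open Literature.Probability.Percolation (crossingProb half coe_half crossingProb_anti_left
  crossingProb_mem_Icc pow_le_crossingProb crossingProb_glue_holds half_le_crossingProb_self
  crossingProb_half_succ_self_holds)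

namespace Lattice

/-! ### Lattice inputs at `p = 1/2` -/

/-- `h(a, n) ∈ (0, 1]`: a probability, positive since the bottom row is open with probability
`2^{-a}` (`pow_le_crossingProb`). [folklore] -/
theorem stripRate_crossingProb_mem_Ioc (a n : ℕ) : crossingProb half a n ∈ Set.Ioc (0 : ℝ) 1 :=
  ⟨(pow_pos (by rw [coe_half]; norm_num) a).trans_le (pow_le_crossingProb half a n),
    (crossingProb_mem_Icc half a n).2⟩

/-- `h(0, n) ≥ 1` (hence `= 1`): a single column is crossed trivially. [folklore] -/
theorem stripRate_one_le_crossingProb_zero (n : ℕ) : 1 ≤ crossingProb half 0 n := by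
  simpa using pow_le_crossingProb half 0 n

/-- Harris gluing through the `n × n` square at `p = 1/2`, where `h(n, n) ≥ 1/2`:
`h(a, n) h(b, n) / 2 ≤ h(a + b - n, n)` for `a, b ≥ n`. [folklore] -/
theorem stripRate_glue {n a b : ℕ} (ha : n ≤ a) (hb : n ≤ b) :
    crossingProb half a n * crossingProb half b n / 2 ≤ crossingProb half (a + b - n) n := by
  have h0 : 0 ≤ crossingProb half a n * crossingProb half b n :=
    mul_nonneg (crossingProb_mem_Icc half a n).1 (crossingProb_mem_Icc half b n).1
  calc crossingProb half a n * crossingProb half b n / 2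
      = crossingProb half a n * crossingProb half b n * (1 / 2) := by ring
    _ ≤ crossingProb half a n * crossingProb half b n * crossingProb half n n :=
        mul_le_mul_of_nonneg_left (half_le_crossingProb_self crossingProb_half_succ_self_holds n) h0
    _ ≤ crossingProb half (a + b - n) n := crossingProb_glue_holds half a b n ha hb

/-! ### The Fekete function `A w = -log h(⌊(n + 2) w⌋₊ - 1, n)` and its four properties -/

/-- `A` is non-decreasing on `(0, ∞)` (`h(·, n)` is non-increasing in the width). [folklore] -/
theorem stripRate_fn_mono (n : ℕ) (A : ℝ → ℝ)
    (hA : ∀ w, A w = -Real.log (crossingProb half (⌊((n : ℝ) + 2) * w⌋₊ - 1) n)) :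
    ∀ s t : ℝ, 0 < s → s ≤ t → A s ≤ A t := by
  intro s t _ hst
  rw [hA, hA, neg_le_neg_iff]
  refine Real.log_le_log (stripRate_crossingProb_mem_Ioc _ _).1 (crossingProb_anti_left _ ?_ _)
  have hk : (0 : ℝ) ≤ (n : ℝ) + 2 := by positivity
  exact Nat.sub_le_sub_right (Nat.floor_mono (mul_le_mul_of_nonneg_left hst hk)) 1

/-- `A` is non-negative (`h ≤ 1`). [folklore] -/
theorem stripRate_fn_nonneg (n : ℕ) (A : ℝ → ℝ)
    (hA : ∀ w, A w = -Real.log (crossingProb half (⌊((n : ℝ) + 2) * w⌋₊ - 1) n)) :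
    ∀ s : ℝ, 0 < s → 0 ≤ A s := by
  intro s _
  rw [hA, neg_nonneg]
  exact Real.log_nonpos (crossingProb_mem_Icc _ _ _).1 (crossingProb_mem_Icc _ _ _).2

/-- `A` is superadditive on `(0, ∞)`: sub-multiplicativity `h(a₁ + a₂ + 1, n) ≤ h(a₁, n) h(a₂, n)`
and `⌊x⌋₊ + ⌊y⌋₊ ≤ ⌊x + y⌋₊` (with `h(0, n) = 1` when one of the floors vanishes). [folklore] -/
theorem stripRate_fn_superadd (n : ℕ) (A : ℝ → ℝ)
    (hA : ∀ w, A w = -Real.log (crossingProb half (⌊((n : ℝ) + 2) * w⌋₊ - 1) n)) :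
    ∀ s t : ℝ, 0 < s → 0 < t → A s + A t ≤ A (s + t) := by
  intro s t hs ht
  have hk : (0 : ℝ) ≤ (n : ℝ) + 2 := by positivity
  -- `⌊k s⌋₊ + ⌊k t⌋₊ ≤ ⌊k (s + t)⌋₊`
  have hfl : ⌊((n : ℝ) + 2) * s⌋₊ + ⌊((n : ℝ) + 2) * t⌋₊ ≤ ⌊((n : ℝ) + 2) * (s + t)⌋₊ := by
    refine Nat.le_floor ?_
    push_cast
    rw [mul_add]
    exact add_le_add (Nat.floor_le (by positivity)) (Nat.floor_le (by positivity))
  rw [hA, hA, hA]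
  generalize ⌊((n : ℝ) + 2) * s⌋₊ = I at hfl ⊢
  generalize ⌊((n : ℝ) + 2) * t⌋₊ = J at hfl ⊢
  generalize ⌊((n : ℝ) + 2) * (s + t)⌋₊ = M at hfl ⊢
  have h1 := stripRate_one_le_crossingProb_zero n
  have hp1 := (stripRate_crossingProb_mem_Ioc (I - 1) n).1
  have hp2 := (stripRate_crossingProb_mem_Ioc (J - 1) n).1
  -- the crossing inequality behind superadditivity: `h(M - 1) ≤ h(I - 1) h(J - 1)`
  have key : crossingProb half (M - 1) n ≤ crossingProb half (I - 1) n * crossingProb half (J - 1) n := by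
    rcases Nat.eq_zero_or_pos I with rfl | hI
    · rw [Nat.zero_sub]
      exact (crossingProb_anti_left _ (by omega) _).trans (le_mul_of_one_le_left hp2.le h1)
    rcases Nat.eq_zero_or_pos J with rfl | hJ
    · rw [Nat.zero_sub]
      exact (crossingProb_anti_left _ (by omega) _).trans (le_mul_of_one_le_right hp1.le h1)
    exact (crossingProb_anti_left _ (show I - 1 + (J - 1) + 1 ≤ M - 1 by omega) _).trans
      (crossingProb_add_succ_le_mul half _ _ n)
  have hlog := Real.log_le_log ((stripRate_crossingProb_mem_Ioc (M - 1) n).1) key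
  rw [Real.log_mul hp1.ne' hp2.ne'] at hlog
  linarith

/-- `A` is nearly subadditive with defect `log 2`: `A (s + t - 1) ≤ A s + A t + log 2` for `s, t ≥ 1`,
by Harris gluing through the `n × n` square (`stripRate_glue`) and
`⌊x + y⌋₊ ≤ ⌊x⌋₊ + ⌊y⌋₊ + 1`. [folklore] -/
theorem stripRate_fn_nearSubadd (n : ℕ) (A : ℝ → ℝ)
    (hA : ∀ w, A w = -Real.log (crossingProb half (⌊((n : ℝ) + 2) * w⌋₊ - 1) n)) :
    ∀ s t : ℝ, 1 ≤ s → 1 ≤ t → A (s + t - 1) ≤ A s + A t + Real.log 2 := by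
  intro s t hs ht
  have hk : (0 : ℝ) ≤ (n : ℝ) + 2 := by positivity
  have hks : (n : ℝ) + 2 ≤ ((n : ℝ) + 2) * s := le_mul_of_one_le_right hk hs
  have hkt : (n : ℝ) + 2 ≤ ((n : ℝ) + 2) * t := le_mul_of_one_le_right hk ht
  have hfs : n + 2 ≤ ⌊((n : ℝ) + 2) * s⌋₊ := Nat.le_floor (by push_cast; exact hks)
  have hft : n + 2 ≤ ⌊((n : ℝ) + 2) * t⌋₊ := Nat.le_floor (by push_cast; exact hkt)
  have hst : (0 : ℝ) ≤ ((n : ℝ) + 2) * (s + t - 1) := mul_nonneg hk (by linarith)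
  -- `⌊k (s + t - 1)⌋₊ + k = ⌊k s + k t⌋₊ ≤ ⌊k s⌋₊ + ⌊k t⌋₊ + 1`
  have hsum : ⌊((n : ℝ) + 2) * (s + t - 1)⌋₊ + (n + 2) ≤
      ⌊((n : ℝ) + 2) * s⌋₊ + ⌊((n : ℝ) + 2) * t⌋₊ + 1 := by
    have e : ((n : ℝ) + 2) * s + ((n : ℝ) + 2) * t =
        ((n : ℝ) + 2) * (s + t - 1) + ((n + 2 : ℕ) : ℝ) := by push_cast; ring
    rw [← Nat.floor_add_natCast hst (n + 2), ← e, ← Nat.lt_succ_iff,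
      Nat.floor_lt (add_nonneg (hk.trans hks) (hk.trans hkt))]
    push_cast
    linarith [Nat.lt_floor_add_one (((n : ℝ) + 2) * s), Nat.lt_floor_add_one (((n : ℝ) + 2) * t)]
  rw [hA, hA, hA]
  generalize ⌊((n : ℝ) + 2) * s⌋₊ = I at hfs hsum ⊢
  generalize ⌊((n : ℝ) + 2) * t⌋₊ = J at hft hsum ⊢
  generalize ⌊((n : ℝ) + 2) * (s + t - 1)⌋₊ = M at hsum ⊢
  have hg := stripRate_glue (n := n) (a := I - 1) (b := J - 1) (by omega) (by omega)
  have hmono := crossingProb_anti_left half (show M - 1 ≤ I - 1 + (J - 1) - n by omega) n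
  have hp1 := (stripRate_crossingProb_mem_Ioc (I - 1) n).1
  have hp2 := (stripRate_crossingProb_mem_Ioc (J - 1) n).1
  have hlog := Real.log_le_log (div_pos (mul_pos hp1 hp2) two_pos) (hg.trans hmono)
  rw [Real.log_div (mul_pos hp1 hp2).ne' two_ne_zero, Real.log_mul hp1.ne' hp2.ne'] at hlog
  linarith

/-- The Fekete sandwich of `A`: a slope `l` with `A 1 ≤ l ≤ A 2 + log 2`, `A w ≤ l w` (`w > 0`) and
`l (w - 1) - log 2 ≤ A w` (`w ≥ 1`) (`quasiadditive_linear_sandwich`). [folklore] -/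
theorem stripRate_fekete (n : ℕ) (A : ℝ → ℝ)
    (hA : ∀ w, A w = -Real.log (crossingProb half (⌊((n : ℝ) + 2) * w⌋₊ - 1) n)) :
    ∃ l : ℝ, A 1 ≤ l ∧ l ≤ A 2 + Real.log 2 ∧ (∀ w : ℝ, 0 < w → A w ≤ l * w) ∧
      (∀ w : ℝ, 1 ≤ w → l * (w - 1) - Real.log 2 ≤ A w) :=
  quasiadditive_linear_sandwich A (Real.log 2) (Real.log_nonneg one_le_two)
    (stripRate_fn_mono n A hA) (stripRate_fn_nonneg n A hA) (stripRate_fn_superadd n A hA)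
    (stripRate_fn_nearSubadd n A hA)

/-- `A ((a + 1) / (n + 2)) = -log h(a, n)`: the lattice index `a` sits at `w = (a + 1) / (n + 2)`.
[folklore] -/
theorem stripRate_fn_natCast (n a : ℕ) (A : ℝ → ℝ)
    (hA : ∀ w, A w = -Real.log (crossingProb half (⌊((n : ℝ) + 2) * w⌋₊ - 1) n)) :
    A (((a : ℝ) + 1) / ((n : ℝ) + 2)) = -Real.log (crossingProb half a n) := by
  have hk : (n : ℝ) + 2 ≠ 0 := by positivity
  have e : ((n : ℝ) + 2) * (((a : ℝ) + 1) / ((n : ℝ) + 2)) = ((a + 1 : ℕ) : ℝ) := by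
    push_cast; field_simp
  rw [hA, e, Nat.floor_natCast, Nat.add_sub_cancel]

end Lattice

open Lattice in
/-- **Sub-goal `lattice_stripRate` (line `registered`, lead c6; kernel facts VI, part 1) — the
lattice strip crossing rate at fixed height.** For every `n` there is `ν = ν_n` with
`log 2 / (n + 2) ≤ ν`, `ν (n + 2) ≤ log 2 - log h(2n + 3, n)` and, for every width `a`,
`e^{-ν (a + 1)} ≤ h(a, n) = P_{1/2}(LR([0, a] × [0, n]))` and, if `a ≥ n`,
`h(a, n) ≤ 2 e^{ν (n + 1 - a)}` (Fekete on sub-multiplicativity and Harris gluing).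
[cite: BollobasRiordan2006, Ch. 3, eq. (2), (3) and (12)] -/
theorem lattice_stripRate : ∀ n : ℕ, ∃ ν : ℝ, Real.log 2 / ((n:ℝ) + 2) ≤ ν ∧ ν * ((n:ℝ) + 2) ≤ Real.log 2 - Real.log (Literature.Probability.Percolation.crossingProb Literature.Probability.Percolation.half (2 * n + 3) n) ∧ ∀ a : ℕ, Real.exp (-(ν * ((a:ℝ) + 1))) ≤ Literature.Probability.Percolation.crossingProb Literature.Probability.Percolation.half a n ∧ (n ≤ a → Literature.Probability.Percolation.crossingProb Literature.Probability.Percolation.half a n ≤ 2 * Real.exp (ν * ((n:ℝ) + 1 - a))) := by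
  intro n
  set A : ℝ → ℝ := fun w => -Real.log (crossingProb half (⌊((n : ℝ) + 2) * w⌋₊ - 1) n) with hA_def
  have hA : ∀ w, A w = -Real.log (crossingProb half (⌊((n : ℝ) + 2) * w⌋₊ - 1) n) := fun w => rfl
  obtain ⟨l, h1, h2, hup, hlow⟩ := stripRate_fekete n A hA
  have hk : (0 : ℝ) < (n : ℝ) + 2 := by positivity
  -- `A 1 = -log h(n + 1, n) = log 2` and `A 2 = -log h(2n + 3, n)`
  have hA1 : A 1 = Real.log 2 := by
    have h := stripRate_fn_natCast n (n + 1) A hA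
    rw [show (((n + 1 : ℕ) : ℝ) + 1) / ((n : ℝ) + 2) = 1 by
      rw [div_eq_one_iff_eq hk.ne']; push_cast; ring] at h
    rw [h, crossingProb_half_succ_self_holds n, one_div, Real.log_inv, neg_neg]
  have hA2 : A 2 = -Real.log (crossingProb half (2 * n + 3) n) := by
    have h := stripRate_fn_natCast n (2 * n + 3) A hA
    rwa [show (((2 * n + 3 : ℕ) : ℝ) + 1) / ((n : ℝ) + 2) = 2 by
      rw [div_eq_iff hk.ne']; push_cast; ring] at h
  rw [hA1] at h1
  rw [hA2] at h2
  have hl : 0 ≤ l := (Real.log_nonneg one_le_two).trans h1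
  refine ⟨l / ((n : ℝ) + 2), div_le_div_of_nonneg_right h1 hk.le, ?_, fun a => ⟨?_, ?_⟩⟩
  · rw [div_mul_cancel₀ l hk.ne']
    linarith
  · -- lower bound at the lattice index `a`: `w := (a + 1) / (n + 2)`
    have h := hup _ (by positivity : 0 < ((a : ℝ) + 1) / ((n : ℝ) + 2))
    rw [stripRate_fn_natCast n a A hA] at h
    have e : l * (((a : ℝ) + 1) / ((n : ℝ) + 2)) = l / ((n : ℝ) + 2) * ((a : ℝ) + 1) := by ring
    calc Real.exp (-(l / ((n : ℝ) + 2) * ((a : ℝ) + 1)))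
        ≤ Real.exp (Real.log (crossingProb half a n)) := Real.exp_le_exp.mpr (by linarith)
      _ = crossingProb half a n := Real.exp_log ((stripRate_crossingProb_mem_Ioc a n).1)
  · intro hna
    rcases hna.eq_or_lt with rfl | hlt
    · -- `a = n`: `h ≤ 1 ≤ 2 e^{ν}`
      have e : l / ((n : ℝ) + 2) * ((n : ℝ) + 1 - n) = l / ((n : ℝ) + 2) := by ring
      have hν : (1 : ℝ) ≤ Real.exp (l / ((n : ℝ) + 2) * ((n : ℝ) + 1 - n)) := by
        rw [e]; exact Real.one_le_exp (div_nonneg hl hk.le)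
      linarith [(crossingProb_mem_Icc half n n).2]
    · -- `a ≥ n + 1`: `w := (a + 1) / (n + 2) ≥ 1`
      have ha : (n : ℝ) + 1 ≤ a := by exact_mod_cast hlt
      have h := hlow _ (by rw [le_div_iff₀ hk]; linarith : 1 ≤ ((a : ℝ) + 1) / ((n : ℝ) + 2))
      rw [stripRate_fn_natCast n a A hA] at h
      have e : l * (((a : ℝ) + 1) / ((n : ℝ) + 2) - 1) =
          -(l / ((n : ℝ) + 2) * ((n : ℝ) + 1 - a)) := by
        field_simp; ring
      rw [e] at h
      calc crossingProb half a n = Real.exp (Real.log (crossingProb half a n)) :=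
            (Real.exp_log ((stripRate_crossingProb_mem_Ioc a n).1)).symm
        _ ≤ Real.exp (Real.log 2 + l / ((n : ℝ) + 2) * ((n : ℝ) + 1 - a)) :=
            Real.exp_le_exp.mpr (by linarith)
        _ = 2 * Real.exp (l / ((n : ℝ) + 2) * ((n : ℝ) + 1 - a)) := by
            rw [Real.exp_add, Real.exp_log two_pos]

/-- **Sub-goal `lattice_stripRate_tendsto` (line `registered`, lead c6; kernel facts VI, part 1) —
the strip rate is the exponential decay rate of `h(·, n)`.** If `ν` satisfies the sandwich
`e^{-ν (a + 1)} ≤ h(a, n)` (all `a`) and `h(a, n) ≤ 2 e^{ν (n + 1 - a)}` (`a ≥ n`), then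
`-log h(a, n) / a → ν` as `a → ∞` (squeeze between `ν (1 - (n + 1)/a) - log 2 / a` and
`ν (1 + 1/a)`). [cite: BollobasRiordan2006, Ch. 3, eq. (2), (3) and (12)] -/
theorem lattice_stripRate_tendsto : ∀ (n : ℕ) (ν : ℝ), (∀ a : ℕ, Real.exp (-(ν * ((a:ℝ) + 1))) ≤ Literature.Probability.Percolation.crossingProb Literature.Probability.Percolation.half a n ∧ (n ≤ a → Literature.Probability.Percolation.crossingProb Literature.Probability.Percolation.half a n ≤ 2 * Real.exp (ν * ((n:ℝ) + 1 - a)))) → Filter.Tendsto (fun a : ℕ => -Real.log (Literature.Probability.Percolation.crossingProb Literature.Probability.Percolation.half a n) / (a:ℝ)) Filter.atTop (nhds ν) := by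
  intro n ν hyp
  have h0 : Tendsto (fun a : ℕ => (a : ℝ)⁻¹) atTop (𝓝 0) := tendsto_inv_atTop_nhds_zero_nat
  -- the two envelopes tend to `ν`
  have hupper : Tendsto (fun a : ℕ => ν * (1 + (a : ℝ)⁻¹)) atTop (𝓝 ν) := by
    simpa using ((tendsto_const_nhds (x := (1 : ℝ))).add h0).const_mul ν
  have hlower : Tendsto (fun a : ℕ => ν * (1 - ((n : ℝ) + 1) * (a : ℝ)⁻¹) - Real.log 2 * (a : ℝ)⁻¹)
      atTop (𝓝 ν) := by
    simpa using (((tendsto_const_nhds (x := (1 : ℝ))).sub (h0.const_mul ((n : ℝ) + 1))).const_mul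
      ν).sub (h0.const_mul (Real.log 2))
  refine tendsto_of_tendsto_of_tendsto_of_le_of_le' hlower hupper ?_ ?_
  · filter_upwards [eventually_ge_atTop (n + 1)] with a ha
    have hapos : (0 : ℝ) < a := by exact_mod_cast (Nat.succ_pos n).trans_le ha
    obtain ⟨hl, hu⟩ := hyp a
    have hlog := Real.log_le_log ((Real.exp_pos _).trans_le hl) (hu (by omega))
    rw [Real.log_mul two_ne_zero (Real.exp_pos _).ne', Real.log_exp] at hlog
    rw [le_div_iff₀ hapos]
    have e : (ν * (1 - ((n : ℝ) + 1) * (a : ℝ)⁻¹) - Real.log 2 * (a : ℝ)⁻¹) * a =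
        -(ν * ((n : ℝ) + 1 - a)) - Real.log 2 := by
      field_simp; ring
    rw [e]
    linarith
  · filter_upwards [eventually_ge_atTop 1] with a ha
    have hapos : (0 : ℝ) < a := by exact_mod_cast ha
    obtain ⟨hl, -⟩ := hyp a
    have hlog := Real.log_le_log (Real.exp_pos _) hl
    rw [Real.log_exp] at hlog
    rw [div_le_iff₀ hapos]
    have e : ν * (1 + (a : ℝ)⁻¹) * a = ν * ((a : ℝ) + 1) := by
      field_simp
    rw [e]
    linarith

end Summit.CriticalPhenomena.CardyFormulaZ2.Cruxes.SubseqCardy.Birth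

end
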